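import Literature.Analysis.FluidPDE.ConvexIntegration2DIteration
import HarnessLib

/-!
# Convex integration in 2-D: estimates along the iteration

Topic `Analysis/FluidPDE`. Support file (layer 5a' of 5) for the proof of
`ConvexIntegrationLemma2DBall` (Chiodaroli–De Lellis–Kreml 2015, Lemma 3.7 on a ball): for a run
`d : IterData` of `ConvexIntegration2DIteration.lean`,

* uniform bounds (`abs_state_le`), the pairing `ip` and the energies `E_k = ‖p_k‖²_{L²}`,
  `E_succ`, `abs_ip_incr_state_le` (`|⟨w_k, p_j⟩| ≤ 4ε_k`, `j ≤ k`), `E_le`;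
* `F_monotone` (`F_k = E_k + 8∑_{i<k} ε_i`), `ip_sub_le` (`‖p_m - p_n‖² ≤ F_m - F_n` — the
  near-orthogonality of each increment to the whole past makes the states Cauchy in `L²`,
  `cauchy`; this replaces CDK's points of continuity of the Baire-1 maps `I_N`);
* `J_succ_le` (`J_{k+1} ≤ J_k + 5ε_k - βJ_k²`, the bookkeeping of claim (Cl)) and `tendsto_J`
  (`∫_Ω (C - |ṽ + v̲_k|²) → 0`).

## References

* E. Chiodaroli, C. De Lellis, O. Kreml, *Global ill-posedness of the isentropic system of gas
  dynamics*, Comm. Pure Appl. Math. 68 (2015) 1157–1190, §4.1.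
-/

noncomputable section

open MeasureTheory Set Metric Filter Function
open scoped ContDiff Topology NNReal

namespace Literature.Analysis.FluidPDE.ConvexIntegration

namespace IterData

variable (d : IterData)

/-! ### Estimates along the iteration -/

/-- The states are continuous. [folklore] -/
theorem state_continuous (k : ℕ) (c : Fin 4) : Continuous (d.state k c) :=
  ((d.state_memX0 k).smooth c).continuous

/-- The states are compactly supported. [folklore] -/
theorem state_hasCompactSupport (k : ℕ) (c : Fin 4) : HasCompactSupport (d.state k c) :=
  (d.state_memX0 k).hasCompactSupport c

/-- The increments are continuous. [folklore] -/
theorem incr_continuous (k : ℕ) (c : Fin 4) : Continuous (d.incr k c) :=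
  (d.incr_smooth k c).continuous

/-- `w_k = p_{k+1} - p_k`. [folklore] -/
theorem incr_eq_sub (k : ℕ) (c : Fin 4) (z : ST) :
    d.incr k c z = d.state (k + 1) c z - d.state k c z := by
  rw [d.state_succ_apply]; ring

/-- The states vanish off `Ω`. [folklore] -/
theorem state_eq_zero (k : ℕ) {z : ST} (hz : z ∉ d.Ω) (c : Fin 4) : d.state k c z = 0 :=
  (d.state_memX0 k).p_eq_zero hz c

/-- The increments vanish off `Ω`. [folklore] -/
theorem incr_eq_zero (k : ℕ) {z : ST} (hz : z ∉ d.Ω) (c : Fin 4) : d.incr k c z = 0 := by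
  rw [d.incr_eq_sub, d.state_eq_zero k hz, d.state_eq_zero (k + 1) hz, sub_zero]

/-- The uniform bound `R = √C + 2C + ∑ |qt_c|` on the components of all states. [folklore] -/
def R : ℝ := Real.sqrt d.C + 2 * d.C + ∑ c, |d.qt c|

/-- `R ≥ 0`. [folklore] -/
theorem R_nonneg : 0 ≤ d.R := by
  unfold R; have := d.hC.le; positivity

/-- The components of all states are bounded by `R`. [folklore] -/
theorem abs_state_le (k : ℕ) (c : Fin 4) (z : ST) : |d.state k c z| ≤ d.R := by
  have h := ((d.state_memX0 k).inU z).inUbar.coord_bound c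
  rw [stateOf_apply] at h
  have hq : |d.qt c| ≤ ∑ c, |d.qt c| :=
    Finset.single_le_sum (f := fun c => |d.qt c|) (fun c _ => abs_nonneg _) (Finset.mem_univ c)
  calc |d.state k c z| = |(d.qt c + d.state k c z) - d.qt c| := by ring_nf
    _ ≤ |d.qt c + d.state k c z| + |d.qt c| := abs_sub _ _
    _ ≤ d.R := by unfold R; linarith

/-- The `L²` pairing of two perturbations (all four components). [folklore] -/
def ip (u v : Fin 4 → ST → ℝ) : ℝ := ∑ c, ∫ z, u c z * v c z

/-- The pairing is symmetric. [folklore] -/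
theorem ip_comm (u v : Fin 4 → ST → ℝ) : ip u v = ip v u := by
  simp only [ip, mul_comm]

/-- Products of a state component with a continuous function are integrable. [folklore] -/
theorem integrable_state_mul {k : ℕ} {c : Fin 4} {f : ST → ℝ} (hf : Continuous f) :
    Integrable (fun z => d.state k c z * f z) :=
  integrable_mul_of_cs (d.state_continuous k c) (d.state_hasCompactSupport k c) hf

/-- Products of an increment component with a continuous function are integrable. [folklore] -/
theorem integrable_incr_mul {k : ℕ} {c : Fin 4} {f : ST → ℝ} (hf : Continuous f) :
    Integrable (fun z => d.incr k c z * f z) :=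
  integrable_mul_of_cs (d.incr_continuous k c) (d.incr_hasCompactSupport k c) hf

/-- `∫ (f + g + h) = ∫ f + ∫ g + ∫ h` for integrable functions. [folklore] -/
theorem integral_add_add {f g h : ST → ℝ} (hf : Integrable f) (hg : Integrable g)
    (hh : Integrable h) :
    ∫ z, (f z + g z + h z) = (∫ z, f z) + (∫ z, g z) + ∫ z, h z := by
  have hfg : Integrable (fun z => f z + g z) := hf.add hg
  rw [integral_add hfg hh, integral_add hf hg]

/-- The energy `E_k = ‖p_k‖²_{L²}`. [folklore] -/
def E (k : ℕ) : ℝ := ip (d.state k) (d.state k)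

/-- `E_{k+1} = E_k + 2⟨p_k, w_k⟩ + ‖w_k‖²`. [folklore] -/
theorem E_succ (k : ℕ) :
    d.E (k + 1) = d.E k + 2 * ip (d.state k) (d.incr k) + ip (d.incr k) (d.incr k) := by
  simp only [E, ip, Finset.mul_sum, ← Finset.sum_add_distrib]
  refine Finset.sum_congr rfl fun c _ => ?_
  have h1 := d.integrable_state_mul (k := k) (c := c) (d.state_continuous k c)
  have h2 := d.integrable_state_mul (k := k) (c := c) (d.incr_continuous k c)
  have h3 := d.integrable_incr_mul (k := k) (c := c) (d.incr_continuous k c)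
  have : (fun z => d.state (k + 1) c z * d.state (k + 1) c z)
      = fun z => d.state k c z * d.state k c z + 2 * (d.state k c z * d.incr k c z)
        + d.incr k c z * d.incr k c z := by
    funext z; rw [d.state_succ_apply]; ring
  rw [this, integral_add_add h1 (h2.const_mul 2) h3, integral_const_mul]

/-- `|⟨w_k, p_j⟩| ≤ 4 ε_k` for `j ≤ k`. [folklore] -/
theorem abs_ip_incr_state_le {k j : ℕ} (hj : j ≤ k) : |ip (d.incr k) (d.state j)| ≤ 4 * d.eps k := by
  unfold ip
  calc |∑ c, ∫ z, d.incr k c z * d.state j c z| ≤ ∑ c, |∫ z, d.incr k c z * d.state j c z| :=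
        Finset.abs_sum_le_sum_abs _ _
    _ ≤ ∑ _c : Fin 4, d.eps k := Finset.sum_le_sum fun c _ => d.incr_orth_state hj c c
    _ = 4 * d.eps k := by simp

/-- `⟨u, u⟩ ≥ 0`. [folklore] -/
theorem ip_self_nonneg (u : Fin 4 → ST → ℝ) : 0 ≤ ip u u :=
  Finset.sum_nonneg fun _ _ => integral_nonneg fun _ => mul_self_nonneg _

/-- The energies are bounded: `E_k ≤ 4 R² |Ω|`. [folklore] -/
theorem E_le (k : ℕ) : d.E k ≤ 4 * d.R ^ 2 * volume.real d.Ω := by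
  unfold E ip
  have hΩ : volume d.Ω < ⊤ := d.hΩb.measure_lt_top
  have : ∀ c, ∫ z, d.state k c z * d.state k c z ≤ d.R ^ 2 * volume.real d.Ω := by
    intro c
    rw [← setIntegral_eq_integral_of_forall_compl_eq_zero (s := d.Ω)
      (fun z hz => by rw [d.state_eq_zero k hz c, zero_mul])]
    have h := norm_setIntegral_le_of_norm_le_const (μ := volume) (s := d.Ω)
      (f := fun z => d.state k c z * d.state k c z) hΩ (C := d.R ^ 2) (fun z _ => by
        rw [Real.norm_eq_abs, abs_mul, sq]
        exact mul_le_mul (d.abs_state_le k c z) (d.abs_state_le k c z) (abs_nonneg _) d.R_nonneg)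
    exact (le_abs_self _).trans ((Real.norm_eq_abs _).symm.le.trans h)
  calc ∑ c, ∫ z, d.state k c z * d.state k c z ≤ ∑ _c : Fin 4, d.R ^ 2 * volume.real d.Ω :=
        Finset.sum_le_sum fun c _ => this c
    _ = 4 * d.R ^ 2 * volume.real d.Ω := by simp; ring

/-- The corrected energies `F_k = E_k + 8 ∑_{i<k} ε_i`. [folklore] -/
def F (k : ℕ) : ℝ := d.E k + 8 * ∑ i ∈ Finset.range k, d.eps i

/-- The corrected energies are non-decreasing. [folklore] -/
theorem F_monotone : Monotone d.F := by
  refine monotone_nat_of_le_succ fun k => ?_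
  simp only [F, Finset.sum_range_succ, d.E_succ]
  have h1 := d.abs_ip_incr_state_le (le_refl k)
  rw [ip_comm] at h1
  have h2 := ip_self_nonneg (d.incr k)
  have := neg_abs_le (ip (d.state k) (d.incr k))
  linarith

/-- The corrected energies are bounded. [folklore] -/
theorem F_le (k : ℕ) : d.F k ≤ 4 * d.R ^ 2 * volume.real d.Ω + 8 * d.θ := by
  unfold F
  linarith [d.E_le k, d.sum_eps_le (Finset.range k)]

/-- **The `L²` increments are controlled by the corrected energies:**
`‖p_m - p_n‖² ≤ F_m - F_n` for `n ≤ m` (near-orthogonality of the increments to the past).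
[folklore] -/
theorem ip_sub_le (n m : ℕ) (hnm : n ≤ m) :
    ip (fun c z => d.state m c z - d.state n c z) (fun c z => d.state m c z - d.state n c z)
      ≤ d.F m - d.F n := by
  -- exact identity `‖p_m - p_n‖² = E_m - E_n - 2 ∑_{k ∈ [n, m)} ⟨w_k, p_n⟩`, by induction on `m`
  have key : ∀ j : ℕ, ip (fun c z => d.state (n + j) c z - d.state n c z)
      (fun c z => d.state (n + j) c z - d.state n c z)
      = d.E (n + j) - d.E n - 2 * ∑ k ∈ Finset.range j, ip (d.incr (n + k)) (d.state n) := by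
    intro j
    induction j with
    | zero => simp [ip, E]
    | succ j ih =>
      rw [Finset.sum_range_succ, ← add_assoc, d.E_succ (n + j)]
      -- `X' = X + w`, `‖X + w‖² = ‖X‖² + 2⟨X, w⟩ + ‖w‖²`, `⟨X, w⟩ = ⟨p_{n+j}, w⟩ - ⟨p_n, w⟩`
      have hX : ip (fun c z => d.state (n + j + 1) c z - d.state n c z)
          (fun c z => d.state (n + j + 1) c z - d.state n c z)
          = ip (fun c z => d.state (n + j) c z - d.state n c z)
              (fun c z => d.state (n + j) c z - d.state n c z)
            + 2 * (ip (d.state (n + j)) (d.incr (n + j)) - ip (d.incr (n + j)) (d.state n))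
            + ip (d.incr (n + j)) (d.incr (n + j)) := by
        simp only [ip, Finset.mul_sum, ← Finset.sum_sub_distrib, ← Finset.sum_add_distrib]
        refine Finset.sum_congr rfl fun c _ => ?_
        set w := d.incr (n + j) c
        set a := d.state (n + j) c
        set b := d.state n c
        have hw : Continuous w := d.incr_continuous _ c
        have ha : Continuous a := d.state_continuous _ c
        have hb : Continuous b := d.state_continuous _ c
        have i1 : Integrable (fun z => (a z - b z) * (a z - b z)) :=
          integrable_mul_of_cs (ha.sub hb) ((d.state_hasCompactSupport _ c).sub
            (d.state_hasCompactSupport _ c)) (ha.sub hb)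
        have i2 : Integrable (fun z => a z * w z) := d.integrable_state_mul hw
        have i3 : Integrable (fun z => w z * b z) := d.integrable_incr_mul hb
        have i4 : Integrable (fun z => w z * w z) := d.integrable_incr_mul hw
        have : (fun z => (d.state (n + j + 1) c z - b z) * (d.state (n + j + 1) c z - b z))
            = fun z => (a z - b z) * (a z - b z) + 2 * (a z * w z - w z * b z) + w z * w z := by
          funext z; rw [d.state_succ_apply]; ring
        have i23 : Integrable (fun z => a z * w z - w z * b z) := i2.sub i3
        rw [this, integral_add_add i1 (i23.const_mul 2) i4, integral_const_mul, integral_sub i2 i3]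
      rw [hX, ih]
      ring
  obtain ⟨j, rfl⟩ := Nat.exists_eq_add_of_le hnm
  rw [key j]
  simp only [F, Finset.sum_range_add]
  have hb : ∀ k ∈ Finset.range j, -ip (d.incr (n + k)) (d.state n) ≤ 4 * d.eps (n + k) :=
    fun k _ => (neg_le_abs _).trans (d.abs_ip_incr_state_le (Nat.le_add_right n k))
  have hs := Finset.sum_le_sum hb
  rw [Finset.sum_neg_distrib, ← Finset.mul_sum] at hs
  linarith


/-- **The states form a Cauchy sequence in `L²`.** [cite: ChiodaroliDeLellisKreml2015, §4.1 (strong `L²` convergence at points of continuity)] -/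
theorem cauchy {η : ℝ} (hη : 0 < η) : ∃ M : ℕ, ∀ n m, M ≤ n → n ≤ m →
    ip (fun c z => d.state m c z - d.state n c z) (fun c z => d.state m c z - d.state n c z) < η := by
  obtain ⟨M, hM⟩ := exists_forall_sub_lt_of_monotone d.F_monotone d.F_le hη
  exact ⟨M, fun n m hn hnm => (d.ip_sub_le n m hnm).trans_lt (hM n m hn hnm)⟩

/-- `Ω` has finite measure. [folklore] -/
theorem volume_ne_top : volume d.Ω ≠ ⊤ := d.hΩb.measure_lt_top.ne

/-- `Ω` has positive measure. [folklore] -/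
theorem volume_real_pos : 0 < volume.real d.Ω :=
  ENNReal.toReal_pos (d.hΩo.measure_pos volume d.hΩne).ne' d.volume_ne_top

/-- The gain constant is positive. [folklore] -/
theorem stepGain_pos : 0 < stepGain d.C d.Ω := by
  unfold stepGain; have := d.hC; have := d.volume_real_pos; positivity

/-- The defect `J_k = ∫_Ω (C - |ṽ + v̲_k|²)` of the `k`-th state. [folklore] -/
def J (k : ℕ) : ℝ := defect d.C d.qt d.Ω (d.state k)

/-- The defects are non-negative. [folklore] -/
theorem J_nonneg (k : ℕ) : 0 ≤ d.J k := (d.state_memX0 k).defect_nonneg d.hΩo.measurableSet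

/-- The trace density of a state is integrable on `Ω`. [folklore] -/
theorem integrableOn_trM_state (k : ℕ) :
    IntegrableOn (fun z => trM d.C (stateOf d.qt (d.state k) z)) d.Ω :=
  (((continuous_trM d.C).comp (d.state_memX0 k).continuous_stateOf).continuousOn.integrableOn_compact
    d.hΩb.isCompact_closure).mono_set subset_closure

/-- **The defect recursion** `J_{k+1} ≤ J_k + 5ε_k - β J_k²`. [cite: ChiodaroliDeLellisKreml2015, §4.1 (proof of (Cl): `liminf ‖ṽ+v_k‖² ≥ ‖ṽ+v̲‖² + β(C|Γ| - ‖ṽ+v̲‖²)²`)] -/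
theorem J_succ_le (k : ℕ) : d.J (k + 1) ≤ d.J k + 5 * d.eps k - stepGain d.C d.Ω * d.J k ^ 2 := by
  -- the difference of the trace densities, `-G`, is supported in `Ω`
  have hpt : ∀ z, trM d.C (stateOf d.qt (d.state (k + 1)) z) - trM d.C (stateOf d.qt (d.state k) z)
      = -(2 * ((d.qt 0 + d.state k 0 z) * d.incr k 0 z) + 2 * ((d.qt 1 + d.state k 1 z) * d.incr k 1 z)
        + (d.incr k 0 z ^ 2 + d.incr k 1 z ^ 2)) := by
    intro z
    simp only [trM_eq, stateOf_apply, d.state_succ_apply]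
    ring
  have hdiff : d.J (k + 1) - d.J k
      = -∫ z, (2 * ((d.qt 0 + d.state k 0 z) * d.incr k 0 z)
          + 2 * ((d.qt 1 + d.state k 1 z) * d.incr k 1 z) + (d.incr k 0 z ^ 2 + d.incr k 1 z ^ 2)) := by
    have e1 : d.J (k + 1) - d.J k = ∫ z in d.Ω, (trM d.C (stateOf d.qt (d.state (k + 1)) z)
        - trM d.C (stateOf d.qt (d.state k) z)) := by
      rw [integral_sub (d.integrableOn_trM_state (k + 1)) (d.integrableOn_trM_state k)]; rfl
    rw [e1, setIntegral_congr_fun d.hΩo.measurableSet (fun z _ => hpt z), integral_neg,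
      setIntegral_eq_integral_of_forall_compl_eq_zero]
    intro z hz
    simp [d.incr_eq_zero k hz]
  -- evaluate `∫ G`
  have hsw : ∀ c, Integrable (fun z => (d.qt c + d.state k c z) * d.incr k c z) := fun c => by
    have : (fun z => (d.qt c + d.state k c z) * d.incr k c z)
        = fun z => d.incr k c z * (d.qt c + d.state k c z) := by
      funext z; ring
    rw [this]
    exact d.integrable_incr_mul (continuous_const.add (d.state_continuous k c))
  have hww : Integrable (fun z => d.incr k 0 z ^ 2 + d.incr k 1 z ^ 2) := by
    have : ∀ c, Integrable (fun z => d.incr k c z ^ 2) := fun c => by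
      simpa [sq] using d.integrable_incr_mul (k := k) (c := c) (d.incr_continuous k c)
    exact (this 0).add (this 1)
  have hG : ∫ z, (2 * ((d.qt 0 + d.state k 0 z) * d.incr k 0 z)
        + 2 * ((d.qt 1 + d.state k 1 z) * d.incr k 1 z) + (d.incr k 0 z ^ 2 + d.incr k 1 z ^ 2))
      = 2 * (∫ z, (d.qt 0 + d.state k 0 z) * d.incr k 0 z)
        + 2 * (∫ z, (d.qt 1 + d.state k 1 z) * d.incr k 1 z)
        + ∫ z, (d.incr k 0 z ^ 2 + d.incr k 1 z ^ 2) := by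
    rw [integral_add_add ((hsw 0).const_mul 2) ((hsw 1).const_mul 2) hww, integral_const_mul,
      integral_const_mul]
  have hmix : ∀ c, |∫ z, (d.qt c + d.state k c z) * d.incr k c z| ≤ d.eps k := by
    intro c
    have e : (fun z => (d.qt c + d.state k c z) * d.incr k c z)
        = fun z => d.qt c * d.incr k c z + d.incr k c z * d.state k c z := by
      funext z; ring
    have iw : Integrable (d.incr k c) :=
      (d.incr_continuous k c).integrable_of_hasCompactSupport (d.incr_hasCompactSupport k c)
    rw [e, integral_add (iw.const_mul _) (d.integrable_incr_mul (d.state_continuous k c)),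
      integral_const_mul, d.integral_incr k c, mul_zero, zero_add]
    exact d.incr_orth_state (le_refl k) c c
  have hgain := d.incr_gain k
  have h0 := abs_le.mp (hmix 0)
  have h1 := abs_le.mp (hmix 1)
  have : d.J (k + 1) - d.J k ≤ 5 * d.eps k - stepGain d.C d.Ω * d.J k ^ 2 := by
    rw [hdiff, hG]
    simp only [J] at hgain ⊢
    linarith
  linarith

/-- **The defects tend to zero:** `∫_Ω (C - |ṽ + v̲_k|²) → 0`. [cite: ChiodaroliDeLellisKreml2015, §4.1] -/
theorem tendsto_J : Tendsto d.J atTop (𝓝 0) :=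
  tendsto_zero_of_sq_recursion d.stepGain_pos d.J_nonneg (fun k => by linarith [d.eps_nonneg k])
    (d.summable_eps.mul_left 5) (fun k => by linarith [d.J_succ_le k])

end IterData

end Literature.Analysis.FluidPDE.ConvexIntegration
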